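import Literature.InformationTheory.QuantumCodes.OptimalDistanceThreeCodes
import HarnessLib

/-!
# Pure distance-three codes from the syndrome table; the pure `[[17,11,3]]` code of Yu et al.'s Lemma 1

Topic `Literature/InformationTheory/QuantumCodes` (venture QEC, cell `qec`; LIT-1 custody, the `d = 3` column).
S. Yu, J. Bierbrauer, Y. Dong, Q. Chen, C. H. Oh, *All the stabilizer codes of distance 3*, IEEE Trans. Inform.
Theory 59 (2013) 5179 = arXiv:0901.1968 [YuEtAl2013], §III Lemma 1 and its proof (lit chunk p0005 L11–40, read on
the page 2026-08-27): «Non-degenerate optimal 1-error correcting codes of lengths `10 ≤ n ≤ 17` and `30 ≤ n ≤ 37`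
exist. Proof. … Also it is not difficult to check that the optimal stabilizer code `[[17,11,3]]` found in
Ref. [cal2] (= [CalderbankEtAl1998]) by a random search is non-degenerate, whose stabilizer reads»
```
I I X I Z Y Z Y X X Z Y I I X X Y
I I Z X I Z I Y Y Y X X Z Y Y X X
I X I I X Z X Z Y Y Y I Y X Z I Y
I Z I Z Z I Y X Y X Z Y Z X Z Z X
X I I Z Y I I X Z Z Y X Y Z I Y X
Z I I X Y Y Y I Y I Y X I X X Z Y      [17] = [[17,11,3]]
```
(the six rows of the displayed array, p0005 L33–38, leftmost letter = qubit `0`). For a pure code of distance `3`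
«all errors happened on up to 2 qubits can be detected» (p0003 L31–33), i.e. (Gottesman 1997 §3.3, the perfect-code
count «every possible error syndrome is used by the single-qubit errors») the `3n` single-qubit errors have NONZERO and
PAIRWISE DISTINCT syndromes.

## Formalisation (all PROVED; no named facts, no `sorry`)

* `syndBit g i p` — the syndrome bit `((g, E))` of the single-qubit error `E = (x|z)` at qubit `i` against a generator
  `g = (a|b)`: `aᵢ z + x bᵢ` (`sympInner_singleErr`); `exists_two_singleErr_of_sympWeight_eq_two` — a weight-two word
  is the sum of two single-qubit errors at distinct qubits; `exists_pauliPair_eq` — the three nonzero letters.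
* **`isPure_three_of_syndromes`** — THE CRITERION: if every single-qubit error has a nonzero syndrome and single-qubit
  errors at distinct qubits have distinct syndromes, the span of the generators is pure to distance `3`;
  **`pureAdditiveCodeExists_three_of_syndromes`** — plus pairwise commuting generators (`s` of them, any rank) gives a
  pure `[[n, k, 3]]` for every `k ≤ n − s` (exact `k` by `PureAdditiveCodeExists.anti`). Both hypotheses are finite
  decidable tests on the generator rows (what a certificate checker evaluates), discharged below by `decide`.
* `code17Rows` (the printed stabilizer), `sympInner_code17Rows`, `code17Rows_syndromes_ne_zero`,
  `code17Rows_syndromes_ne` (kernel `decide`), **`pureAdditiveCodeExists_17_11_3`** — Lemma 1's pure `[[17,11,3]]`.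
* Consequences for Theorem 2 (`OptimalDistanceThreeCodes.lean` takes Lemma 1's small codes as hypotheses): the block
  families become UNCONDITIONAL for `β = 0` (`[17]`, this file), `β = 1` (`[16] = [2⁴]`), `β = 4` (`[13] = [2³] ▷ [5]`)
  in range (a) and `β = 0` (`[37] = [2⁵] ▷ [5]`), `β = 5` (`[32] = [2⁵]`) in range (b):
  `YuEtAl2013_theorem2a_blocks_beta0/1/4`, `YuEtAl2013_theorem2b_blocks_beta0/5` — infinite families of pure
  `[[n, n − 2m − 4, 3]]` / `[[n, n − 2m − 5, 3]]` codes, `m ≥ 2`, `3 ≤ a ≤ 2^{2m−1}` resp. `2^{2m}`.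

Deliberately NOT here: the other codes of Lemma 1 (Tables IV–VI of the paper are not in our text source). Tree search
(2026-08-27): `singleErr`, `pauliPair`, `exists_singleErr_of_sympWeight_eq_one`, `mem_sympDual_span_range_iff`,
`isSelfOrthogonal_span_range_iff`, `IsSelfOrthogonal.finrank_le`, `PureAdditiveCodeExists.anti`,
`YuEtAl2013_theorem2a_blocks/2b_blocks`, `pureAdditiveCodeExists_16_10_3/13_7_3/32_25_3/37_30_3` — reused; the
five-qubit code's purity is by `decide` over all `2^{10}` words (`isAdditiveCode_fiveQubitCode`), infeasible at
`n = 17` (`2^{34}` words), hence the syndrome criterion. The census (Summits side) has its own certificate kernel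
(`AddCert`), not importable into Literature; no `[[17,11,3]]` purity theorem was in the tree.
-/

namespace Literature.InformationTheory.QuantumCodes

open Finset Module Matrix

variable {n : ℕ}

/-! ### 1. Syndromes of single-qubit errors; words of weight two -/

/-- The **syndrome bit** of the single-qubit error `E = (x|z)` at qubit `i` against the generator `g = (a|b)`:
`((g, E)) = aᵢ z + x bᵢ`. [cite: Gottesman1997, §3.4 (chunk p0021 L55-56: «evaluating the inner product with the rows»)] -/
def syndBit (g : SympVec n) (i : Fin n) (p : ZMod 2 × ZMod 2) : ZMod 2 := g.1 i * p.2 + p.1 * g.2 i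

/-- `((g, E)) = syndBit g i (x,z)` for `E = (x|z)` at qubit `i`. [cite: Gottesman1997, §3.4 (chunk p0021 L55-56)] -/
theorem sympInner_singleErr (g : SympVec n) (i : Fin n) (p : ZMod 2 × ZMod 2) :
    sympInner g (singleErr i p) = syndBit g i p := by
  simp [sympInner, singleErr, syndBit]

/-- Every nonzero letter `(x|z) ∈ 𝔽₂² ∖ 0` is one of `X = (1|0)`, `Z = (0|1)`, `Y = (1|1)` (`pauliPair`).
[cite: Gottesman1997, §7.1 (chunk p0055 L27-30)] -/
theorem exists_pauliPair_eq {p : ZMod 2 × ZMod 2} (hp : p ≠ 0) : ∃ a, pauliPair a = p := by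
  revert p
  decide

/-- **A word of weight two is the sum of two single-qubit errors at distinct qubits.**
[cite: Gottesman1997, §7.1 (chunk p0055 L27-30)] -/
theorem exists_two_singleErr_of_sympWeight_eq_two {e : SympVec n} (h : sympWeight e = 2) :
    ∃ i i' : Fin n, i ≠ i' ∧ ∃ p p' : ZMod 2 × ZMod 2, p ≠ 0 ∧ p' ≠ 0 ∧ e = singleErr i p + singleErr i' p' := by
  classical
  unfold sympWeight at h
  obtain ⟨i, i', hii', hs⟩ := Finset.card_eq_two.1 h
  have hoff : ∀ j, j ≠ i → j ≠ i' → e.1 j = 0 ∧ e.2 j = 0 := fun j hj hj' => by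
    have : j ∉ ({i, i'} : Finset (Fin n)) := by simp [hj, hj']
    rw [← hs] at this
    simpa [not_or] using this
  have hin : ∀ j, j ∈ ({i, i'} : Finset (Fin n)) → e.1 j ≠ 0 ∨ e.2 j ≠ 0 := fun j hj => by
    rw [← hs] at hj
    simpa using hj
  refine ⟨i, i', hii', (e.1 i, e.2 i), (e.1 i', e.2 i'), ?_, ?_, ?_⟩
  · intro h0
    simp only [Prod.mk_eq_zero] at h0
    have := hin i (by simp)
    tauto
  · intro h0
    simp only [Prod.mk_eq_zero] at h0
    have := hin i' (by simp)
    tauto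
  · ext j
    · by_cases hj : j = i
      · subst hj; simp [singleErr, hii']
      · by_cases hj' : j = i'
        · subst hj'; simp [singleErr, hj]
        · simp [singleErr, hj, hj', (hoff j hj hj').1]
    · by_cases hj : j = i
      · subst hj; simp [singleErr, hii']
      · by_cases hj' : j = i'
        · subst hj'; simp [singleErr, hj]
        · simp [singleErr, hj, hj', (hoff j hj hj').2]

/-- In `𝔽₂`, `x + y = 0` forces `x = y`. [folklore] -/
private theorem eq_of_add_eq_zero_zmod2 : ∀ x y : ZMod 2, x + y = 0 → x = y := by decide

/-! ### 2. The criterion -/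

/-- **Purity to distance three from the syndrome table**: if every single-qubit error `X_i, Y_i, Z_i` has a
nonzero syndrome and single-qubit errors at different qubits have different syndromes, then no nonzero Pauli word
of weight `≤ 2` commutes with all generators — the stabilizer they span is pure (non-degenerate) to distance `3`
(«all errors happened on up to 2 qubits can be detected»).
[cite: YuEtAl2013, §I (chunk p0003 L31-33) and §III Lemma 1 (chunk p0005 L11-40); Gottesman1997, §3.3 (chunk p0020 L55-57)] -/
theorem isPure_three_of_syndromes {s : ℕ} (g : Fin s → SympVec n)
    (h1 : ∀ (i : Fin n) (a : Fin 3), ∃ j, syndBit (g j) i (pauliPair a) ≠ 0)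
    (h2 : ∀ (i i' : Fin n) (a a' : Fin 3), i ≠ i' →
      ∃ j, syndBit (g j) i (pauliPair a) ≠ syndBit (g j) i' (pauliPair a')) :
    IsPure (Submodule.span (ZMod 2) (Set.range g)) 3 := by
  classical
  intro w hw hw0
  by_contra hlt
  rw [not_le] at hlt
  have horth : ∀ j, sympInner (g j) w = 0 := (mem_sympDual_span_range_iff g w).1 hw
  have hw1 : sympWeight w ≠ 0 := fun h0 => hw0 ((sympWeight_eq_zero_iff w).1 h0)
  rcases (show sympWeight w = 1 ∨ sympWeight w = 2 by omega) with h | h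
  · obtain ⟨i, p, hp, rfl⟩ := exists_singleErr_of_sympWeight_eq_one h
    obtain ⟨a, rfl⟩ := exists_pauliPair_eq hp
    obtain ⟨j, hj⟩ := h1 i a
    exact hj (by rw [← sympInner_singleErr]; exact horth j)
  · obtain ⟨i, i', hii', p, p', hp, hp', rfl⟩ := exists_two_singleErr_of_sympWeight_eq_two h
    obtain ⟨a, rfl⟩ := exists_pauliPair_eq hp
    obtain ⟨a', rfl⟩ := exists_pauliPair_eq hp'
    obtain ⟨j, hj⟩ := h2 i i' a a' hii'
    apply hj
    have h0 := horth j
    rw [sympInner_comm, sympInner_add_left, sympInner_comm _ (g j), sympInner_comm _ (g j),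
      sympInner_singleErr, sympInner_singleErr] at h0
    exact eq_of_add_eq_zero_zmod2 _ _ h0

/-- **A pure `[[n, k, 3]]` code from `s` pairwise commuting generators passing the syndrome test**, for every
`k ≤ n − s` (the span has dimension `r ≤ s`, giving a pure `[[n, n − r, 3]]`; fewer logical qubits by CRSS
Thm. 6 (c), `PureAdditiveCodeExists.anti`). [cite: YuEtAl2013, §III Lemma 1 (chunk p0005 L11-40); CalderbankEtAl1998, §4 Thm. 6 (c) (printed p. 13)] -/
theorem pureAdditiveCodeExists_three_of_syndromes {s k : ℕ} (g : Fin s → SympVec n)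
    (h0 : ∀ a b, sympInner (g a) (g b) = 0)
    (h1 : ∀ (i : Fin n) (a : Fin 3), ∃ j, syndBit (g j) i (pauliPair a) ≠ 0)
    (h2 : ∀ (i i' : Fin n) (a a' : Fin 3), i ≠ i' →
      ∃ j, syndBit (g j) i (pauliPair a) ≠ syndBit (g j) i' (pauliPair a'))
    (hk : k + s ≤ n) : PureAdditiveCodeExists n k 3 := by
  have hso : IsSelfOrthogonal (Submodule.span (ZMod 2) (Set.range g)) := (isSelfOrthogonal_span_range_iff g).2 h0
  have hpure := isPure_three_of_syndromes g h1 h2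
  have hr : finrank (ZMod 2) (Submodule.span (ZMod 2) (Set.range g)) ≤ s := by
    have h := finrank_range_le_card (R := ZMod 2) g
    simp only [Set.finrank, Fintype.card_fin] at h
    exact h
  have hle := hso.finrank_le
  have h : PureAdditiveCodeExists n (n - finrank (ZMod 2) (Submodule.span (ZMod 2) (Set.range g))) 3 :=
    ⟨_, ⟨hso, by omega, hpure.hasMinDist, fun _ v hv hv0 => hpure v (hso hv) hv0⟩, hpure⟩
  exact h.anti (by omega)

/-! ### 3. The pure `[[17,11,3]]` code (Yu et al. Lemma 1; the code of CRSS's random search) -/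

/-- The printed stabilizer of `[17] = [[17,11,3]]`, rows as `(x-part | z-part)` (`I = (0|0)`, `X = (1|0)`,
`Z = (0|1)`, `Y = (1|1)`; leftmost letter = qubit `0`):
`IIXIZYZYXXZYIIXXY`, `IIZXIZIYYYXXZYYXX`, `IXIIXZXZYYYIYXZIY`, `IZIZZIYXYXZYZXZZX`, `XIIZYIIXZZYXYZIYX`,
`ZIIXYYYIYIYXIXXZY`. [cite: YuEtAl2013, §III Lemma 1 (chunk p0005 L28-40, the displayed array «[17]=[[17,11,3]]»)] -/
def code17Rows : Fin 6 → SympVec 17 := ![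
    (![0,0,1,0,0,1,0,1,1,1,0,1,0,0,1,1,1], ![0,0,0,0,1,1,1,1,0,0,1,1,0,0,0,0,1]),
    (![0,0,0,1,0,0,0,1,1,1,1,1,0,1,1,1,1], ![0,0,1,0,0,1,0,1,1,1,0,0,1,1,1,0,0]),
    (![0,1,0,0,1,0,1,0,1,1,1,0,1,1,0,0,1], ![0,0,0,0,0,1,0,1,1,1,1,0,1,0,1,0,1]),
    (![0,0,0,0,0,0,1,1,1,1,0,1,0,1,0,0,1], ![0,1,0,1,1,0,1,0,1,0,1,1,1,0,1,1,0]),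
    (![1,0,0,0,1,0,0,1,0,0,1,1,1,0,0,1,1], ![0,0,0,1,1,0,0,0,1,1,1,0,1,1,0,1,0]),
    (![0,0,0,1,1,1,1,0,1,0,1,1,0,1,1,0,1], ![1,0,0,0,1,1,1,0,1,0,1,0,0,0,0,1,1])]

set_option maxRecDepth 65536 in
/-- The six printed generators pairwise commute. [cite: YuEtAl2013, §III Lemma 1 (chunk p0005 L22-40)] -/
theorem sympInner_code17Rows : ∀ a b, sympInner (code17Rows a) (code17Rows b) = 0 := by
  decide

set_option maxRecDepth 65536 in
/-- Every single-qubit error has a nonzero syndrome against the printed `[[17,11,3]]` generators.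
[cite: YuEtAl2013, §III Lemma 1 (chunk p0005 L22-40: «non-degenerate»)] -/
theorem code17Rows_syndromes_ne_zero :
    ∀ (i : Fin 17) (a : Fin 3), ∃ j, syndBit (code17Rows j) i (pauliPair a) ≠ 0 := by
  decide

set_option maxRecDepth 65536 in
/-- Single-qubit errors at different qubits have different syndromes against the printed `[[17,11,3]]` generators
(the `51` syndromes are pairwise distinct). [cite: YuEtAl2013, §III Lemma 1 (chunk p0005 L22-40: «non-degenerate»)] -/
theorem code17Rows_syndromes_ne :
    ∀ (i i' : Fin 17) (a a' : Fin 3), i ≠ i' →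
      ∃ j, syndBit (code17Rows j) i (pauliPair a) ≠ syndBit (code17Rows j) i' (pauliPair a') := by
  decide

/-- **Lemma 1, length 17: a pure (non-degenerate) `[[17,11,3]]` stabilizer code exists** — the optimal code of
CRSS's random search, with the printed stabilizer. [cite: YuEtAl2013, §III Lemma 1 (chunk p0005 L11-40)] -/
theorem pureAdditiveCodeExists_17_11_3 : PureAdditiveCodeExists 17 11 3 :=
  pureAdditiveCodeExists_three_of_syndromes code17Rows sympInner_code17Rows code17Rows_syndromes_ne_zero
    code17Rows_syndromes_ne (by norm_num)

/-! ### 4. Unconditional block families of Theorem 2 -/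

/-- **Theorem 2 (a), `β = 0`, unconditional**: for `m ≥ 2` and `3 ≤ a ≤ 2^{2m−1}` the stabilizer
`[8·a] ▷ [2^{2m}] ▷ … ▷ [2^6] ▷ [17]` is a pure `[[n, n − 2m − 4, 3]]`, `n = 8a + (4^{m+1} − 64)/3 + 17`.
[cite: YuEtAl2013, §III Thm. 2 (a) (chunk p0005 L60-68) with Lemma 1 (L11-40)] -/
theorem YuEtAl2013_theorem2a_blocks_beta0 {m a : ℕ} (hm : 2 ≤ m) (ha3 : 3 ≤ a) (ha : a ≤ 2 ^ (2 * m - 1)) :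
    PureAdditiveCodeExists (8 * a + ((4 ^ (m + 1) - 64) / 3 + 17))
      (8 * a + ((4 ^ (m + 1) - 64) / 3 + 17) - (2 * m + 4)) 3 := by
  simpa using YuEtAl2013_theorem2a_blocks (β := 0) hm ha3 ha (by norm_num) (by simpa using pureAdditiveCodeExists_17_11_3)

/-- **Theorem 2 (a), `β = 1`, unconditional** (`[16] = [2⁴]`, Gottesman): `n = 8a + (4^{m+1} − 64)/3 + 16`.
[cite: YuEtAl2013, §III Thm. 2 (a) (chunk p0005 L60-68) with Lemma 1 (L42: «pure optimal codes of lengths 16 and 32 exist»)] -/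
theorem YuEtAl2013_theorem2a_blocks_beta1 {m a : ℕ} (hm : 2 ≤ m) (ha3 : 3 ≤ a) (ha : a ≤ 2 ^ (2 * m - 1)) :
    PureAdditiveCodeExists (8 * a + ((4 ^ (m + 1) - 64) / 3 + 16))
      (8 * a + ((4 ^ (m + 1) - 64) / 3 + 16) - (2 * m + 4)) 3 := by
  simpa using YuEtAl2013_theorem2a_blocks (β := 1) hm ha3 ha (by norm_num) (by simpa using pureAdditiveCodeExists_16_10_3)

/-- **Theorem 2 (a), `β = 4`, unconditional** (`[13] = [2³] ▷ [5]`): `n = 8a + (4^{m+1} − 64)/3 + 13`.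
[cite: YuEtAl2013, §III Thm. 2 (a) (chunk p0005 L60-68) with §II (chunk p0004 L104-109: «[13]=[[13,7,3]] by pasting»)] -/
theorem YuEtAl2013_theorem2a_blocks_beta4 {m a : ℕ} (hm : 2 ≤ m) (ha3 : 3 ≤ a) (ha : a ≤ 2 ^ (2 * m - 1)) :
    PureAdditiveCodeExists (8 * a + ((4 ^ (m + 1) - 64) / 3 + 13))
      (8 * a + ((4 ^ (m + 1) - 64) / 3 + 13) - (2 * m + 4)) 3 := by
  simpa using YuEtAl2013_theorem2a_blocks (β := 4) hm ha3 ha (by norm_num) (by simpa using pureAdditiveCodeExists_13_7_3)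

/-- **Theorem 2 (b), `β = 0`, unconditional** (`[37] = [2⁵] ▷ [5]`): for `m ≥ 2`, `3 ≤ a ≤ 2^{2m}` a pure
`[[n, n − 2m − 5, 3]]`, `n = 8a + 2(4^{m+1} − 64)/3 + 37`. [cite: YuEtAl2013, §III Thm. 2 (b) (chunk p0005 L69-80) with Lemma 1 (L17-20)] -/
theorem YuEtAl2013_theorem2b_blocks_beta0 {m a : ℕ} (hm : 2 ≤ m) (ha3 : 3 ≤ a) (ha : a ≤ 2 ^ (2 * m)) :
    PureAdditiveCodeExists (8 * a + (2 * (4 ^ (m + 1) - 64) / 3 + 37))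
      (8 * a + (2 * (4 ^ (m + 1) - 64) / 3 + 37) - (2 * m + 5)) 3 := by
  simpa using YuEtAl2013_theorem2b_blocks (β := 0) hm ha3 ha (by norm_num) (by simpa using pureAdditiveCodeExists_37_30_3)

/-- **Theorem 2 (b), `β = 5`, unconditional** (`[32] = [2⁵]`): `n = 8a + 2(4^{m+1} − 64)/3 + 32`.
[cite: YuEtAl2013, §III Thm. 2 (b) (chunk p0005 L69-80) with Lemma 1 (L42)] -/
theorem YuEtAl2013_theorem2b_blocks_beta5 {m a : ℕ} (hm : 2 ≤ m) (ha3 : 3 ≤ a) (ha : a ≤ 2 ^ (2 * m)) :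
    PureAdditiveCodeExists (8 * a + (2 * (4 ^ (m + 1) - 64) / 3 + 32))
      (8 * a + (2 * (4 ^ (m + 1) - 64) / 3 + 32) - (2 * m + 5)) 3 := by
  simpa using YuEtAl2013_theorem2b_blocks (β := 5) hm ha3 ha (by norm_num) (by simpa using pureAdditiveCodeExists_32_25_3)

end Literature.InformationTheory.QuantumCodes
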